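import Summits.AtomisticToContinuum.Crystallization.Theorems.ChargedEnergyGapBlockFubini
import HarnessLib

/-!
# Charged energy gap — lens-3 g64, node «BarlowRef» (R3) — part 9 (independent): WEIGHTED shares and the HARMONIC criterion of P-Z₅d (lever (α′))

Imports only the tree (`…BlockFubini`, part 7).  ELEMENTARY·PROVED, finite double counting.  Part 7 assigns a pair's weight UNIFORMLY over the
members of its block, so feasibility is decided by the WORST member's per-capita load; here the shares are WEIGHTED, `σ p c ∝ φ c` on the block,
and the natural choice `φ c = β c / Λ c` (budget over certified load rate) turns the feasibility condition into the HARMONIC CRITERION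
`Σ_{c ∈ B(p)} β c / Λ c ≥ M` per block — decided by the block AVERAGE of `β/Λ`, not by the worst member (memo g64 §3, addendum 7: at the record the
certified worst-member ratio is `≈ 0.65–0.85` but the block harmonic mean is `≈ 0.26`, exact `0.035`).

* ★ `sum_le_sum_budget_of_weightedBlocks` — shares `φ c / Φ₀` on blocks with `Φ₀ ≤ Σ_{B p} φ`; per-carrier hypothesis `φ c · load c ≤ Φ₀ · β c`;
* ★ `sum_le_sum_budget_of_harmonic` — loads `load c ≤ Λ c · M` (the shape `TubeShareBoundH` delivers, `Λ c = θ_{ℓ(c)}`, `M` the block count scale)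
  and the harmonic criterion `M ≤ Σ_{c ∈ B p} β c / Λ c` ⟹ `Σ_p w p ≤ Σ_c β c`;
* `sum_le_sum_budget_of_harmonic_classes` — the same with `Λ` constant on finitely many LEVEL CLASSES and the criterion stated through per-class
  member counts `n p i ≤ #{c ∈ B p | cls c = i}` and per-class budget floors `b i ≤ β c`: `M ≤ Σ_i n p i · b i / Λ i`.

0 sorry; standard axioms.
-/

noncomputable section

open scoped Classical

namespace Summit.AtomisticToContinuum.Crystallization.Theorems.ChargedEnergyGapChartDial

section HarmonicShares

variable {π κ ι : Type*}

/-- ★ WEIGHTED BLOCK SHARES: weights `φ c` on carriers (no sign needed), every block heavy enough (`Φ₀ ≤ Σ_{c ∈ B p} φ c`, `Φ₀ > 0`), and every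
carrier's `φ`-weighted load within `Φ₀` times its budget ⟹ `Σ_p w p ≤ Σ_c β c`.  (Part 7's uniform lemma is `φ ≡ 1`, `Φ₀ = N`.) -/
theorem sum_le_sum_budget_of_weightedBlocks (Pairs : Finset π) (Car : Finset κ) (B : π → Finset κ) (w : π → ℝ) (β φ : κ → ℝ) {Φ₀ : ℝ}
    (hΦ₀ : 0 < Φ₀) (hw : ∀ p ∈ Pairs, 0 ≤ w p) (hB : ∀ p ∈ Pairs, B p ⊆ Car)
    (hΦ : ∀ p ∈ Pairs, Φ₀ ≤ ∑ c ∈ B p, φ c)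
    (hload : ∀ c ∈ Car, φ c * ∑ p ∈ Pairs with c ∈ B p, w p ≤ Φ₀ * β c) :
    ∑ p ∈ Pairs, w p ≤ ∑ c ∈ Car, β c := by
  have h1 : ∀ p ∈ Pairs, w p ≤ ∑ c ∈ Car, (if c ∈ B p then φ c / Φ₀ * w p else 0) := by
    intro p hp
    rw [← Finset.sum_filter, Finset.filter_mem_eq_inter, Finset.inter_eq_right.mpr (hB p hp), ← Finset.sum_mul, ← Finset.sum_div]
    calc w p = 1 * w p := (one_mul _).symm
      _ ≤ (∑ c ∈ B p, φ c) / Φ₀ * w p := by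
          refine mul_le_mul_of_nonneg_right ?_ (hw p hp)
          rw [le_div_iff₀ hΦ₀, one_mul]; exact hΦ p hp
  have h2 : ∀ c ∈ Car, ∑ p ∈ Pairs, (if c ∈ B p then φ c / Φ₀ * w p else 0) ≤ β c := by
    intro c hc
    rw [← Finset.sum_filter, ← Finset.mul_sum, div_mul_eq_mul_div, div_le_iff₀ hΦ₀]
    calc φ c * ∑ p ∈ Pairs with c ∈ B p, w p ≤ Φ₀ * β c := hload c hc
      _ = β c * Φ₀ := mul_comm _ _
  calc ∑ p ∈ Pairs, w p ≤ ∑ p ∈ Pairs, ∑ c ∈ Car, (if c ∈ B p then φ c / Φ₀ * w p else 0) := Finset.sum_le_sum h1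
    _ = ∑ c ∈ Car, ∑ p ∈ Pairs, (if c ∈ B p then φ c / Φ₀ * w p else 0) := Finset.sum_comm
    _ ≤ ∑ c ∈ Car, β c := Finset.sum_le_sum h2

/-- ★ THE HARMONIC CRITERION: per-carrier loads `Σ_{p : c ∈ B p} w p ≤ Λ c · M` with certified rates `Λ c > 0` (the shape of `TubeShareBoundH`,
`Λ c = θ_{ℓ(c)}`), budgets `β c ≥ 0`, and every block satisfying `M ≤ Σ_{c ∈ B p} β c / Λ c` ⟹ `Σ_p w p ≤ Σ_c β c`.
(Shares `φ c = β c / (Λ c · M)`, `Φ₀ = 1`.  With `β ≡ β₀` and `Λ ≡ θ` this is part 7's `θ · #B(p) … ` condition; in general it is the statement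
that the block's budget-weighted HARMONIC mean of `Λ/β` is at most `#B(p)/M`.) -/
theorem sum_le_sum_budget_of_harmonic (Pairs : Finset π) (Car : Finset κ) (B : π → Finset κ) (w : π → ℝ) (β Λ : κ → ℝ) {M : ℝ}
    (hM : 0 < M) (hw : ∀ p ∈ Pairs, 0 ≤ w p) (hB : ∀ p ∈ Pairs, B p ⊆ Car) (hβ : ∀ c ∈ Car, 0 ≤ β c) (hΛ : ∀ c ∈ Car, 0 < Λ c)
    (hload : ∀ c ∈ Car, ∑ p ∈ Pairs with c ∈ B p, w p ≤ Λ c * M)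
    (hharm : ∀ p ∈ Pairs, M ≤ ∑ c ∈ B p, β c / Λ c) :
    ∑ p ∈ Pairs, w p ≤ ∑ c ∈ Car, β c := by
  refine sum_le_sum_budget_of_weightedBlocks Pairs Car B w β (fun c => β c / (Λ c * M)) one_pos hw hB ?_ ?_
  · intro p hp
    have : ∑ c ∈ B p, β c / (Λ c * M) = (∑ c ∈ B p, β c / Λ c) / M := by
      rw [Finset.sum_div]; exact Finset.sum_congr rfl fun c _ => by rw [div_div]
    rw [this, le_div_iff₀ hM, one_mul]; exact hharm p hp
  · intro c hc
    rw [one_mul]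
    calc β c / (Λ c * M) * ∑ p ∈ Pairs with c ∈ B p, w p ≤ β c / (Λ c * M) * (Λ c * M) :=
          mul_le_mul_of_nonneg_left (hload c hc) (div_nonneg (hβ c hc) (mul_pos (hΛ c hc) hM).le)
      _ = β c := div_mul_cancel₀ _ (mul_pos (hΛ c hc) hM).ne'

/-- LEVEL CLASSES: the harmonic criterion with `Λ` constant on finitely many classes `cls : κ → ι` (`Λ c = Λc (cls c)`), per-class budget floors
`b i ≤ β c` (`0 ≤ b i`) and per-class member-count floors `n p i ≤ #{c ∈ B p | cls c = i}`: if `M ≤ Σ_{i ∈ I} n p i · b i / Λc i` for every pair's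
block then `Σ_p w p ≤ Σ_c β c`.  This is the form the P-Z₅d census consumes: `Λc i = θ_i` from `TubeShareBoundH … ℓ_i … θ_i` per level band,
`n p i` from the block member counts (part 5 bricks), `b i = B_T · W(ℓ_i⁺)` etc. -/
theorem sum_le_sum_budget_of_harmonic_classes (Pairs : Finset π) (Car : Finset κ) (B : π → Finset κ) (w : π → ℝ) (β : κ → ℝ)
    (I : Finset ι) (cls : κ → ι) (Λc b : ι → ℝ) (n : π → ι → ℝ) {M : ℝ}
    (hM : 0 < M) (hw : ∀ p ∈ Pairs, 0 ≤ w p) (hB : ∀ p ∈ Pairs, B p ⊆ Car) (hcls : ∀ c ∈ Car, cls c ∈ I)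
    (hΛ : ∀ i ∈ I, 0 < Λc i) (hb : ∀ i ∈ I, 0 ≤ b i) (hbβ : ∀ c ∈ Car, b (cls c) ≤ β c)
    (hn : ∀ p ∈ Pairs, ∀ i ∈ I, n p i ≤ ((B p).filter fun c => cls c = i).card)
    (hload : ∀ c ∈ Car, ∑ p ∈ Pairs with c ∈ B p, w p ≤ Λc (cls c) * M)
    (hharm : ∀ p ∈ Pairs, M ≤ ∑ i ∈ I, n p i * b i / Λc i) :
    ∑ p ∈ Pairs, w p ≤ ∑ c ∈ Car, β c := by
  refine sum_le_sum_budget_of_harmonic Pairs Car B w β (fun c => Λc (cls c)) hM hw hB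
    (fun c hc => (hb _ (hcls c hc)).trans (hbβ c hc)) (fun c hc => hΛ _ (hcls c hc)) hload fun p hp => (hharm p hp).trans ?_
  -- Σ_i n_i b_i / Λ_i ≤ Σ_i Σ_{c ∈ B p, cls c = i} β c / Λ c = Σ_{c ∈ B p} β c / Λ c
  have hBI : ∀ c ∈ B p, cls c ∈ I := fun c hc => hcls c (hB p hp hc)
  rw [← Finset.sum_fiberwise_of_maps_to (s := B p) (t := I) (g := cls) hBI]
  refine Finset.sum_le_sum fun i hi => ?_
  calc n p i * b i / Λc i ≤ (((B p).filter fun c => cls c = i).card : ℝ) * b i / Λc i := by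
        gcongr
        · exact (hΛ i hi).le
        · exact hb i hi
        · exact hn p hp i hi
    _ = ∑ c ∈ (B p).filter (fun c => cls c = i), b i / Λc i := by
        rw [Finset.sum_const, nsmul_eq_mul, mul_div_assoc]
    _ ≤ ∑ c ∈ (B p).filter (fun c => cls c = i), β c / Λc (cls c) := by
        refine Finset.sum_le_sum fun c hc => ?_
        rw [Finset.mem_filter] at hc
        have h := hbβ c (hB p hp hc.1)
        rw [hc.2] at h ⊢; exact div_le_div_of_nonneg_right h (hΛ i hi).le

end HarmonicShares

end Summit.AtomisticToContinuum.Crystallization.Theorems.ChargedEnergyGapChartDial
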